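import Literature.InformationTheory.QuantumCodes.QuantumExpanderLTZLemma8Weight
import HarnessLib

/-!
# Quantum expander codes: LTZ15 Lemma 8 — the reduced weight grows by at most a THIRD of the syndrome decrease
# (sharp form of the weight clause, all degrees) — PROOF

Index of sources: `[cite: LeverrierTillichZemor2015]` = Leverrier–Tillich–Zémor, FOCS 2015 / arXiv:1504.00822v1: Lemma 8
(p0008 L104-114) and its proof, App. B (p0013 L10 – p0014 L65: eqs. (partial), (partial2), the four cases, clause (ii)
"the reduced weight `w_R(e+e₁)` is at most equal to the Hamming weight `|e|` of `e`").

qec PARTITION v2 row 04 (`prover-qec-type-04`, gen 6), item «E-7b sharp radius». Sequel to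
`QuantumExpanderLTZLemma8Weight.lean` (clause (ii-weak): `w_R` grows by at most `2·(decrease) − 2`). Here the deficit
`c = |χ_a| + |χ_b| − |x_a| − |x_b|` of the `∂̄`-branch is bounded SHARPLY: `3c + 6 ≤ ∂̄` whenever `c ≥ 1`
(`dbar_deficit_sharp`, an integer inequality using only the Def.-6 size bounds `3|χ_a| + 1 ≤ Δ_B`, `3|χ_b| + 1 ≤ Δ_A`, the
mixed-sign condition of case 4 and the branch condition `6∂ ≤ Δ_A + Δ_B`; in reduced variables `u = |χ_a| − |x_a|`,
`v = |x̄_a| − |x_a| ≥ 2u + 1`, `w = |x_b| − |χ_b|`, `s = |χ_b| − |x̄_b| ∈ [0, w − 1]` it reads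
`(|x_a| + v)w − |x̄_b|u ≥ 3(u − w) + 6`, proved from `3|x_a|(1+2s) ≥ u(6|x_b| − 3) + 6|x_b| − 1 − Δ_A` and a cubic
residual that is non-negative for `u ≥ w + 1`). Consequently:

* `ltz_four_cases_weight_sharp` — the four-case arithmetic exporting, in the `x̄`-branch, either `c < −1` (case 3) or the
  branch condition and the mixed-sign condition of case 4;
* `exists_smallSet_decrease_third_weight_sharp` — **LTZ15 Lemma 8 with the clause
  `3·w_R(e + e₁) ≤ 3·w_R(e) + (|σ_X(e)| − |σ_X(e + e₁)|)` for ALL `(Δ_A, Δ_B)`** (and, as before, the printed clause under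
  `|Δ_A − Δ_B| ≤ 5`).

HONEST FRAMING: the sharp clause is OURS, not the printed statement; `1/3` of the decrease is the best constant obtainable
from the worst-case bounds of App. B (the ratio `c/∂̄` approaches `1/3` along the family `Δ_A = 1`, `|x̄_a| − |χ_a| ≈ Δ_B/6`
— qec cell note E7-REPAIR.md). PROVED (kernel axioms); no definitions, no named facts.
-/

namespace Literature.InformationTheory.QuantumCodes

namespace QuantumExpander

open Finset Matrix

variable {A B : Type*} [Fintype A] [Fintype B] [DecidableEq A] [DecidableEq B]

/-! ### The sharp deficit bound (integers) -/

/-- **Sharp deficit bound, orientation `|x_b| > |x̄_b|`.** In the `∂̄`-branch of LTZ15 App. B case 4 — Def.-6 sizes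
`3|χ_a| + 1 ≤ Δ_B`, `3|χ_b| + 1 ≤ Δ_A`, `|x_b| ≥ |x̄_b| + 1`, deficit `c = |χ_a| + |χ_b| − |x_a| − |x_b| ≥ 1` and branch
condition `6·(eq. (partial) bound) ≤ Δ_A + Δ_B` — the eq. (partial2) bound satisfies `∂̄ ≥ 3c + 6`. Variables:
`X = |x_a|`, `Xb = |x̄_a|`, `Za = |χ_a|`, `Y = |x_b|`, `Yb = |x̄_b|`, `Zb = |χ_b|`. STATUS: OURS (finding E-7 repair), not
printed; the inputs are the printed eqs. (partial), (partial2) and Def. 6.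
[cite: LeverrierTillichZemor2015, App. B eqs. (partial), (partial2) and case 4 (arXiv v1 p0013 L70-90, p0014 L17-65)] -/
theorem dbar_deficit_sharp_orient {dA dB X Xb Za Y Yb Zb : ℤ}
    (hX : 0 ≤ X) (hYb : 0 ≤ Yb)
    (hrow : X + Xb + Za = dB) (hcol : Y + Yb + Zb = dA) (hZa3 : 3 * Za + 1 ≤ dB) (hZb3 : 3 * Zb + 1 ≤ dA)
    (hor' : Yb + 1 ≤ Y) (hc : X + Y + 1 ≤ Za + Zb)
    (hbr : 6 * (X * Yb + Xb * Y - X * Zb - Za * Y) ≤ dA + dB) :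
    3 * (Za + Zb - X - Y) + 6 ≤ X * Yb + Xb * Y - Xb * Zb - Za * Yb := by
  -- reduced variables
  obtain ⟨u, hu_def⟩ : ∃ u, u = Za - X := ⟨_, rfl⟩
  obtain ⟨v, hv_def⟩ : ∃ v, v = Xb - X := ⟨_, rfl⟩
  obtain ⟨w, hw_def⟩ : ∃ w, w = Y - Zb := ⟨_, rfl⟩
  obtain ⟨s, hs_def⟩ : ∃ s, s = Zb - Yb := ⟨_, rfl⟩
  have hv : 2 * u + 1 ≤ v := by linarith
  have hw1 : 1 ≤ w := by linarith
  have hu : w + 1 ≤ u := by linarith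
  have hsw : s + 1 ≤ w := by linarith
  have hY1 : 1 ≤ Y := by linarith
  -- the branch condition in reduced form: v(6Y-1) ≤ u(6Y+1) + dA + 3X + 6Xs
  have hbr' : v * (6 * Y - 1) ≤ u * (6 * Y + 1) + dA + 3 * X + 6 * X * s := by
    have h1 : Xb = X + v := by linarith
    have h2 : Za = X + u := by linarith
    have h3 : Zb = Yb + s := by linarith
    have h4 : dB = 3 * X + v + u := by linarith
    rw [h1, h2, h4, h3] at hbr; linarith
  -- hence (2u+1)(6Y-1) ≤ u(6Y+1) + dA + 3X(1+2s)
  have hstar : u * (6 * Y - 3) + 6 * Y - 1 - dA ≤ 3 * X * (1 + 2 * s) := by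
    have h6Y : 0 ≤ 6 * Y - 1 := by linarith
    have : (2 * u + 1) * (6 * Y - 1) ≤ v * (6 * Y - 1) := mul_le_mul_of_nonneg_right hv h6Y
    nlinarith
  -- `s ≥ 0` (i.e. `T ≥ Ȳ`): otherwise the right side of `hstar` is too small
  have hs0 : 0 ≤ s := by
    by_contra hneg
    push Not at hneg
    have h1 : 3 * X * (1 + 2 * s) ≤ -(3 * X) := by nlinarith
    have h2 : 0 ≤ u * (6 * Y - 3) := mul_nonneg (by linarith) (by linarith)
    have h3 : dA ≤ Yb + Zb + Y := by linarith
    nlinarith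
  -- substitute the column variables: `Y = Yb + s + w`, `Δ_A = 3Yb + 2s + w`
  have hY : Y = Yb + s + w := by linarith
  have hdA' : dA = 3 * Yb + 2 * s + w := by linarith
  have hw0 : 0 ≤ w := by linarith
  have h3s : (0 : ℤ) ≤ 3 * (1 + 2 * s) := by linarith
  -- (a) `3(1+2s)·Xw ≥ w·(u(6Y−3) + 6Y − 1 − Δ_A)`
  have hA : w * (u * (6 * Y - 3) + 6 * Y - 1 - dA) ≤ 3 * (1 + 2 * s) * (X * w) := by
    have := mul_le_mul_of_nonneg_left hstar hw0
    linarith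
  -- (b) `v w ≥ (2u+1) w`
  have hB : 3 * (1 + 2 * s) * ((2 * u + 1) * w) ≤ 3 * (1 + 2 * s) * (v * w) :=
    mul_le_mul_of_nonneg_left (mul_le_mul_of_nonneg_right hv hw0) h3s
  -- (c) the residual polynomial `F(u) = coef·u + const` is non-negative for `u ≥ w + 1`
  have hcoef : 0 ≤ (-6)*s*Yb + (6)*w*Yb + (18)*w*s + (6)*w*w + (-3)*Yb + (-18)*s + (3)*w + (-9) := by
    have h1 : 0 ≤ Yb * (w - s - 1) := mul_nonneg hYb (by linarith)
    have h2 : 0 ≤ s * (w - 1) := mul_nonneg hs0 (by linarith)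
    have h3 : 0 ≤ (w - 1) * (2 * w + 3) := mul_nonneg (by linarith) (by linarith)
    linarith
  have hF1 : 0 ≤ (-6)*w*s*Yb + (6)*w*w*Yb + (18)*w*w*s + (6)*w*w*w + (-6)*s*Yb + (6)*w*Yb + (28)*w*s
      + (14)*w*w + (-3)*Yb + (-50)*s + (5)*w + (-25) := by
    have h1 : 0 ≤ w - s - 1 := by linarith
    have h2 : 0 ≤ w - 1 := by linarith
    have h3 : 0 ≤ Yb * (6 * w * (w - s) + 6 * (w - s) - 3) := by
      refine mul_nonneg hYb ?_
      nlinarith [mul_nonneg hw0 h1]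
    have h4 : 0 ≤ (w - 1) * (6 * w * w + 20 * w + 21) := mul_nonneg h2 (by nlinarith)
    have h5 : 0 ≤ s * (w - 1) * (18 * w + 46) := mul_nonneg (mul_nonneg hs0 h2) (by linarith)
    linarith
  have hFu : 0 ≤ ((-6)*s*Yb + (6)*w*Yb + (18)*w*s + (6)*w*w + (-3)*Yb + (-18)*s + (3)*w + (-9)) * u
      + ((3)*w*Yb + (28)*w*s + (5)*w*w + (-32)*s + (11)*w + (-16)) := by
    have h1 : 0 ≤ ((-6)*s*Yb + (6)*w*Yb + (18)*w*s + (6)*w*w + (-3)*Yb + (-18)*s + (3)*w + (-9)) * (u - w - 1) :=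
      mul_nonneg hcoef (by linarith)
    linarith
  -- (d) assemble: `3(1+2s)·D ≥ 16(1+2s)` for `D = (X+v)w − Yb·u − 3(u − w)`
  obtain ⟨D, hD⟩ : ∃ D, D = (X + v) * w - Yb * u - 3 * (u - w) := ⟨_, rfl⟩
  have hmain : 16 * (1 + 2 * s) ≤ 3 * (1 + 2 * s) * D := by
    rw [hD]
    rw [hY, hdA'] at hA
    linarith
  have h3D : 16 ≤ 3 * D := by
    by_contra hlt
    push Not at hlt
    have : 0 ≤ (15 - 3 * D) * (1 + 2 * s) := mul_nonneg (by linarith) (by linarith)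
    linarith
  have h6 : 6 ≤ D := by omega
  -- back to the original variables
  have h1 : Xb = X + v := by linarith
  have h2 : Za = X + u := by linarith
  have h3 : Zb = Y - w := by linarith
  rw [h1, h2, h3]
  linarith

/-- **Sharp deficit bound, either orientation** (`|x_b| > |x̄_b|` or `|x_a| > |x̄_a|`, as in the mixed-sign case 4): the
statement of `dbar_deficit_sharp_orient` is symmetric under exchanging the roles of `A` and `B`. STATUS: OURS, not printed.
[cite: LeverrierTillichZemor2015, App. B case 4 (arXiv v1 p0014 L17-65)] -/
theorem dbar_deficit_sharp {dA dB X Xb Za Y Yb Zb : ℤ}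
    (hX : 0 ≤ X) (hY : 0 ≤ Y) (hXb : 0 ≤ Xb) (hYb : 0 ≤ Yb)
    (hrow : X + Xb + Za = dB) (hcol : Y + Yb + Zb = dA) (hZa3 : 3 * Za + 1 ≤ dB) (hZb3 : 3 * Zb + 1 ≤ dA)
    (hmix : Yb + 1 ≤ Y ∨ Xb + 1 ≤ X) (hc : X + Y + 1 ≤ Za + Zb)
    (hbr : 6 * (X * Yb + Xb * Y - X * Zb - Za * Y) ≤ dA + dB) :
    3 * (Za + Zb - X - Y) + 6 ≤ X * Yb + Xb * Y - Xb * Zb - Za * Yb := by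
  rcases hmix with hy | hx
  · exact dbar_deficit_sharp_orient hX hYb hrow hcol hZa3 hZb3 hy hc hbr
  · have h := dbar_deficit_sharp_orient (dA := dB) (dB := dA) hY hXb hcol hrow hZb3 hZa3 hx (by linarith)
      (by linarith)
    linarith

/-! ### The four cases, exporting the branch data -/

/-- **The arithmetic of LTZ15 App. B with the data needed for the sharp weight clause.** Hypotheses as in the tree's
`ltz_four_cases_weight`. Conclusion: EITHER `|x_a ∪ x_b| ≤ 3P` (flip inside `E`), OR one of `x̄_a ∪ x̄_b` / its complement
has size `≤ 3Q`, the deficit `c = Za + Zb − X − Y` obeys `3c + 2 < |Δ_A − Δ_B|`, and moreover either `c < −1` (case 3) or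
the branch condition `6P < Δ_A + Δ_B + 1` holds together with the mixed-sign condition `|x̄_b| < |x_b| ∨ |x̄_a| < |x_a|`
(case 4, `∂̄`-branch). STATUS: the case analysis is the paper's; the exported bookkeeping is OURS.
[cite: LeverrierTillichZemor2015, App. B, the four cases (arXiv v1 p0013 L91-149, p0014 L1-65)] -/
theorem ltz_four_cases_weight_sharp {dA dB X Xb Za Y Yb Zb P Q : ℝ} (hdA : 0 < dA) (hdB : 0 < dB)
    (hX : 0 ≤ X) (hXb : 0 ≤ Xb) (hY : 0 ≤ Y) (hYb : 0 ≤ Yb)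
    (hrow : X + Xb + Za = dB) (hcol : Y + Yb + Zb = dA)
    (hZa3 : 3 * Za + 1 ≤ dB) (hZb3 : 3 * Zb + 1 ≤ dA) (hred : 2 * (X + Y) ≤ dA + dB)
    (hP : X * Yb + Xb * Y - X * Zb - Za * Y ≤ P) (hQ : X * Yb + Xb * Y - Xb * Zb - Za * Yb ≤ Q) :
    X + Y ≤ 3 * P ∨
      ((Xb + Yb ≤ 3 * Q ∨ dA + dB - Xb - Yb ≤ 3 * Q) ∧ 3 * (Za + Zb - X - Y) + 2 < |dA - dB| ∧
        (Za + Zb + 1 < X + Y ∨ (6 * P < dA + dB + 1 ∧ (Yb < Y ∨ Xb < X)))) := by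
  by_cases h1 : 3 * (X * dA + Y * dB) ≤ 2 * (dA * dB)
  · -- Case 1 (`x + y ≤ 2/3`): flip `x_a ∪ x_b` (the arithmetic of the tree's `ltz_four_cases`, case 1)
    left
    have hYb' : Yb = dA - Y - Zb := by linarith
    have hXb' : Xb = dB - X - Za := by linarith
    have hP' : X * dA + Y * dB - 2 * X * Y - 2 * X * Zb - 2 * Za * Y ≤ P := by
      rw [hYb', hXb'] at hP; linarith
    have hS0 : 0 ≤ X * dA + Y * dB := by positivity
    have hxy : 2 * X * Y ≤ (X * dA + Y * dB) / 3 := by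
      have hd : 0 < dA * dB := mul_pos hdA hdB
      have hsq : (X * dA + Y * dB) ^ 2 ≤ 2 * (dA * dB) / 3 * (X * dA + Y * dB) := by
        have := mul_le_mul_of_nonneg_left h1 hS0
        nlinarith
      have h4 : 4 * (X * Y) * (dA * dB) ≤ 2 * (dA * dB) / 3 * (X * dA + Y * dB) := by
        nlinarith [sq_nonneg (X * dA - Y * dB)]
      have h5 : 4 * (X * Y) ≤ 2 / 3 * (X * dA + Y * dB) := by
        have := div_le_div_of_nonneg_right h4 hd.le
        rw [mul_div_assoc, div_self hd.ne', mul_one] at this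
        calc 4 * (X * Y) ≤ 2 * (dA * dB) / 3 * (X * dA + Y * dB) / (dA * dB) := this
          _ = 2 / 3 * (X * dA + Y * dB) := by field_simp
      linarith
    have hZb' : 2 * X * Zb ≤ 2 * X * ((dA - 1) / 3) := by
      have : Zb ≤ (dA - 1) / 3 := by linarith
      nlinarith
    have hZa' : 2 * Za * Y ≤ 2 * ((dB - 1) / 3) * Y := by
      have : Za ≤ (dB - 1) / 3 := by linarith
      nlinarith
    nlinarith
  · -- not case 1: `3(X+Y) > 2 min(Δ_A, Δ_B)`, whence the bound on the deficit in terms of `|Δ_A − Δ_B|`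
    have hc_abs : 3 * (Za + Zb - X - Y) + 2 < |dA - dB| := by
      push Not at h1
      rcases le_total dA dB with h | h
      · have hXd : X * dA ≤ X * dB := mul_le_mul_of_nonneg_left h hX
        have h2 : 2 * dA < 3 * (X + Y) := by
          by_contra hn
          push Not at hn
          have : 3 * (X + Y) * dB ≤ 2 * dA * dB := mul_le_mul_of_nonneg_right hn hdB.le
          nlinarith
        rw [abs_sub_comm, abs_of_nonneg (by linarith : (0:ℝ) ≤ dB - dA)]
        linarith
      · have hYd : Y * dB ≤ Y * dA := mul_le_mul_of_nonneg_left h hY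
        have h2 : 2 * dB < 3 * (X + Y) := by
          by_contra hn
          push Not at hn
          have : 3 * (X + Y) * dA ≤ 2 * dB * dA := mul_le_mul_of_nonneg_right hn hdA.le
          nlinarith
        rw [abs_of_nonneg (by linarith : (0:ℝ) ≤ dA - dB)]
        linarith
    by_cases h2 : X ≤ Xb ∧ Y ≤ Yb
    · -- Case 2: flip `x_a ∪ x_b`
      left
      have hYb2 : 1 / 2 ≤ Yb - Zb := by linarith [h2.2]
      have hXb2 : 1 / 2 ≤ Xb - Za := by linarith [h2.1]
      have hP' : X * (Yb - Zb) + Y * (Xb - Za) ≤ P := by linarith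
      nlinarith [mul_le_mul_of_nonneg_left hYb2 hX, mul_le_mul_of_nonneg_left hXb2 hY]
    · by_cases h3 : Xb < X ∧ Yb < Y
      · -- Case 3: flip `x̄_a ∪ x̄_b`; here `c < -1`
        right
        have hX2 : 1 / 2 ≤ X - Za := by linarith [h3.1]
        have hY2 : 1 / 2 ≤ Y - Zb := by linarith [h3.2]
        have hQ' : Yb * (X - Za) + Xb * (Y - Zb) ≤ Q := by linarith
        have hQhalf : (Xb + Yb) / 2 ≤ Q := by
          nlinarith [mul_le_mul_of_nonneg_left hX2 hYb, mul_le_mul_of_nonneg_left hY2 hXb]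
        refine ⟨Or.inl (by linarith [hQhalf]), ?_, Or.inl (by linarith)⟩
        have : 3 * (Za + Zb - X - Y) + 2 < 0 := by linarith
        exact this.trans_le (abs_nonneg _)
      · -- Case 4: mixed signs
        have hmix' : Yb < Y ∨ Xb < X := by
          by_contra hn
          rw [not_or, not_lt, not_lt] at hn
          exact h2 ⟨hn.2, hn.1⟩
        have hmix : (X - Xb) * (Y - Yb) ≤ 0 := by
          by_cases hx : X ≤ Xb
          · have hy : Yb < Y := by
              by_contra hy
              push Not at hy
              exact h2 ⟨hx, hy⟩
            nlinarith [mul_nonneg (sub_nonneg.2 hx) (sub_nonneg.2 hy.le)]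
          · push Not at hx
            have hy : Y ≤ Yb := by
              by_contra hy
              push Not at hy
              exact h3 ⟨hx, hy⟩
            nlinarith [mul_nonneg (sub_nonneg.2 hx.le) (sub_nonneg.2 hy)]
        have hsum : dA + dB + 1 ≤ 3 * (P + Q) := by
          have h2XY : (X + Xb) * (Y + Yb) ≤ 2 * (X * Yb) + 2 * (Xb * Y) := by nlinarith
          have hPQ : 2 * (X * Yb) + 2 * (Xb * Y) - (X + Xb) * Zb - (Y + Yb) * Za ≤ P + Q := by
            nlinarith
          have hA : dB + 1 ≤ 2 * dB - 3 * Za := by linarith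
          have hB : dA + 1 ≤ 2 * dA - 3 * Zb := by linarith
          have hprod : (dB + 1) * (dA + 1) ≤ (2 * dB - 3 * Za) * (2 * dA - 3 * Zb) := by
            have h0' : 0 ≤ dA + 1 := by linarith
            calc (dB + 1) * (dA + 1) ≤ (2 * dB - 3 * Za) * (dA + 1) :=
                  mul_le_mul_of_nonneg_right hA h0'
              _ ≤ (2 * dB - 3 * Za) * (2 * dA - 3 * Zb) :=
                  mul_le_mul_of_nonneg_left hB (by linarith)
          have hXXb : X + Xb = dB - Za := by linarith
          have hYYb : Y + Yb = dA - Zb := by linarith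
          rw [hXXb, hYYb] at hPQ h2XY
          nlinarith
        by_cases h4 : dA + dB + 1 ≤ 6 * P
        · left; linarith
        · have hQ6 : dA + dB + 1 ≤ 6 * Q := by linarith
          right
          refine ⟨?_, hc_abs, Or.inr ⟨by linarith, hmix'⟩⟩
          by_cases h5 : 2 * (Xb + Yb) ≤ dA + dB
          · left; linarith
          · right; linarith


/-- The deficit is at most a third of the decrease in the `x̄`-branch: from the data exported by
`ltz_four_cases_weight_sharp` (either `c < −1`, or the branch condition with the mixed-sign condition) and
`dbar_deficit_sharp`, `3c ≤ Q` (indeed `3c + 6 ≤ Q` when `c ≥ 1`). Variables: `Xa = |x_a|`, `Xbar = |x̄_a|`, `Za = |χ_a|`,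
`Yb = |x_b|`, `Ybar = |x̄_b|`, `Zb = |χ_b|` (naturals); `P`, `Q` the two decreases. STATUS: OURS, not printed.
[cite: LeverrierTillichZemor2015, App. B case 4 (arXiv v1 p0014 L17-65)] -/
theorem deficit_le_third_decrease {dA dB Xa Xbar Za Yb Ybar Zb : ℕ} {P Q : ℝ}
    (hrow : Xa + Xbar + Za = dB) (hcol : Yb + Ybar + Zb = dA) (hZa3 : 3 * Za + 1 ≤ dB) (hZb3 : 3 * Zb + 1 ≤ dA)
    (hP : (Xa : ℝ) * Ybar + Xbar * Yb - Xa * Zb - Za * Yb ≤ P)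
    (hQ : (Xa : ℝ) * Ybar + Xbar * Yb - Xbar * Zb - Za * Ybar ≤ Q) (hQ0 : 0 ≤ Q)
    (hsharp : (Za : ℝ) + Zb + 1 < Xa + Yb ∨ (6 * P < dA + dB + 1 ∧ ((Ybar : ℝ) < Yb ∨ (Xbar : ℝ) < Xa))) :
    3 * ((Za : ℝ) + Zb - Xa - Yb) ≤ Q := by
  rcases hsharp with hlt | ⟨hP6, hmixR⟩
  · linarith
  · by_cases hc0 : Za + Zb ≤ Xa + Yb
    · have : ((Za + Zb : ℕ) : ℝ) ≤ ((Xa + Yb : ℕ) : ℝ) := by exact_mod_cast hc0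
      push_cast at this; linarith
    · push Not at hc0
      have hmixN : (Ybar : ℤ) + 1 ≤ Yb ∨ (Xbar : ℤ) + 1 ≤ Xa := by
        rcases hmixR with hy | hx
        · left
          have : Ybar < Yb := by exact_mod_cast hy
          omega
        · right
          have : Xbar < Xa := by exact_mod_cast hx
          omega
      have hbrR : (((6 * ((Xa : ℤ) * Ybar + Xbar * Yb - Xa * Zb - Za * Yb) : ℤ) : ℝ)) < ((dA + dB + 1 : ℤ) : ℝ) := by
        push_cast; linarith
      have hbrZ : 6 * ((Xa : ℤ) * Ybar + Xbar * Yb - Xa * Zb - Za * Yb) ≤ dA + dB := by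
        have := (Int.cast_lt (R := ℝ)).1 hbrR
        omega
      have hrowZ : (Xa : ℤ) + Xbar + Za = dB := by exact_mod_cast hrow
      have hcolZ : (Yb : ℤ) + Ybar + Zb = dA := by exact_mod_cast hcol
      have hZa3Z : 3 * (Za : ℤ) + 1 ≤ dB := by exact_mod_cast hZa3
      have hZb3Z : 3 * (Zb : ℤ) + 1 ≤ dA := by exact_mod_cast hZb3
      have hcZ : (Xa : ℤ) + Yb + 1 ≤ Za + Zb := by
        have h' : ((Xa + Yb : ℕ) : ℤ) < ((Za + Zb : ℕ) : ℤ) := by exact_mod_cast hc0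
        push_cast at h'; omega
      have hsh : 3 * ((Za : ℤ) + Zb - Xa - Yb) + 6 ≤ (Xa : ℤ) * Ybar + Xbar * Yb - Xbar * Zb - Za * Ybar :=
        dbar_deficit_sharp (Int.natCast_nonneg _) (Int.natCast_nonneg _) (Int.natCast_nonneg _)
          (Int.natCast_nonneg _) hrowZ hcolZ hZa3Z hZb3Z hmixN hcZ hbrZ
      have hshR : ((3 * ((Za : ℤ) + Zb - Xa - Yb) + 6 : ℤ) : ℝ)
          ≤ (((Xa : ℤ) * Ybar + Xbar * Yb - Xbar * Zb - Za * Ybar : ℤ) : ℝ) := by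
        exact_mod_cast hsh
      push_cast at hshR
      linarith

/-! ### LTZ15 Lemma 8 with the sharp weight clause -/

/-- **LTZ15 Lemma 8 with the sharp reduced-weight clause, all degrees.** For a `(Δ_A, Δ_B)`-biregular (`Δ ≥ 1`)
`(γ_A, δ_A, γ_B, δ_B)`-expanding graph with `δ_A, δ_B < 1/6` and an error `e ∉ C_Z^⊥` with `|e| ≤ γ_A n_A`, `|e| ≤ γ_B n_B`,
there are a small set `F` and a word `e'` of `e + 𝟙_F + C_Z^⊥` with
(i) `|F| ≤ 3(|σ_X(e)| − |σ_X(e ⊕ 𝟙_F)|)` — the PRINTED decrease clause;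
(ii-sharp) `3|e'| ≤ 3|e| + (|σ_X(e)| − |σ_X(e ⊕ 𝟙_F)|)` — OURS, NOT the printed statement: the reduced weight grows by at
most a third of the syndrome decrease (the printed clause says it does not grow); and
(ii) if `|Δ_A − Δ_B| ≤ 5` then `|e'| ≤ |e|` — the PRINTED clause under the ADDED near-balance hypothesis.
Proof: as `exists_smallSet_decrease_third_weight`, with `dbar_deficit_sharp` in the `∂̄`-branch when the deficit is positive.
[cite: LeverrierTillichZemor2015, Lemma 8 (arXiv v1 p0008 L104-114) and App. B (p0013 L10 – p0014 L65)] -/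
theorem exists_smallSet_decrease_third_weight_sharp (H : Matrix B A (ZMod 2)) {dA dB : ℕ} {γA δA γB δB : ℝ}
    (hreg : IsBiregular H dA dB) (hexp : IsLeftRightExpanding H dA dB γA δA γB δB)
    (hdA : 0 < dA) (hdB : 0 < dB) (hδA : 0 < δA) (hδA' : δA < 1 / 6) (hδB : 0 < δB) (hδB' : δB < 1 / 6)
    (e : (A × A) ⊕ (B × B) → ZMod 2) (he : e ∉ rowSpace (expanderHZ H))
    (hwA : (hammingNorm e : ℝ) ≤ γA * Fintype.card A) (hwB : (hammingNorm e : ℝ) ≤ γB * Fintype.card B) :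
    ∃ F ∈ smallSets (expanderHZ H), ∃ e' : (A × A) ⊕ (B × B) → ZMod 2,
      (F.card : ℝ) ≤ 3 * syndromeDecrease (expanderHX H) (expanderHX H *ᵥ e) F ∧
      e' - (e + flipVec F) ∈ rowSpace (expanderHZ H) ∧
      3 * (hammingNorm e' : ℝ) ≤ 3 * hammingNorm e + syndromeDecrease (expanderHX H) (expanderHX H *ᵥ e) F ∧
      (|(dA : ℝ) - dB| ≤ 5 → hammingNorm e' ≤ hammingNorm e) := by
  classical
  -- Hamming-minimal representative of the coset
  obtain ⟨eR, heR, hmin⟩ := exists_wnorm_min (expanderHZ H) hammingNorm e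
  have hsyn : expanderHX H *ᵥ eR = expanderHX H *ᵥ e := by
    have h0 := expanderHX_mulVec_eq_zero_of_mem_rowSpace H heR
    rw [Matrix.mulVec_sub, sub_eq_zero] at h0
    exact h0
  have heR_not : eR ∉ rowSpace (expanderHZ H) := by
    intro h
    apply he
    have : e = eR - (eR - e) := by abel
    rw [this]
    exact Submodule.sub_mem _ h heR
  have heR0 : (supp eR).Nonempty := by
    by_contra h0
    rw [Finset.not_nonempty_iff_eq_empty] at h0
    apply heR_not
    have hz : eR = 0 := by
      ext q
      by_contra hq
      have : q ∈ supp eR := by simpa [supp] using hq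
      rw [h0] at this
      exact Finset.notMem_empty _ this
    rw [hz]; exact Submodule.zero_mem _
  have hsupp : (supp eR).card = hammingNorm eR := by simp [supp, hammingNorm]
  have hle : hammingNorm eR ≤ hammingNorm e := hmin e (by simp)
  have hcardA : ((supp eR).card : ℝ) ≤ γA * Fintype.card A := by
    rw [hsupp]; exact le_trans (by exact_mod_cast hle) hwA
  have hcardB : ((supp eR).card : ℝ) ≤ γB * Fintype.card B := by
    rw [hsupp]; exact le_trans (by exact_mod_cast hle) hwB
  -- critical generator
  obtain ⟨b, a, Χa, Χb, hc⟩ :=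
    exists_isCritical H hreg hexp hdA hdB hδA.le hδB.le (supp eR) heR0 hcardA hcardB
  -- the index sets
  set Xa := critX H eR b a Χa with hXa
  set Yb := critY H eR b a Χb with hYb
  set Xbar := (nbrs Hᵀ b \ Χa).filter fun α => eR (Sum.inl (α, a)) = 0 with hXbar
  set Ybar := (nbrs H a \ Χb).filter fun β => eR (Sum.inr (b, β)) = 0 with hYbar
  have hXbar_sub : Xbar ⊆ nbrs Hᵀ b := fun α h => (Finset.mem_sdiff.1 (Finset.mem_filter.1 h).1).1
  have hYbar_sub : Ybar ⊆ nbrs H a := fun β h => (Finset.mem_sdiff.1 (Finset.mem_filter.1 h).1).1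
  -- row / column sums
  have hXbar' : (nbrs Hᵀ b \ Χa).filter (fun α => ¬ (eR (Sum.inl (α, a)) ≠ 0)) = Xbar :=
    Finset.filter_congr (fun α _ => by rw [not_not])
  have hYbar' : (nbrs H a \ Χb).filter (fun β => ¬ (eR (Sum.inr (b, β)) ≠ 0)) = Ybar :=
    Finset.filter_congr (fun β _ => by rw [not_not])
  have hΧa_le : Χa.card ≤ dB := by
    have := Finset.card_le_card hc.Χa_subset; rwa [card_nbrs_transpose_eq H hreg b] at this
  have hΧb_le : Χb.card ≤ dA := by
    have := Finset.card_le_card hc.Χb_subset; rwa [card_nbrs_eq H hreg a] at this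
  have hrowN : Xa.card + Xbar.card + Χa.card = dB := by
    have h1 : Xa.card + Xbar.card = (nbrs Hᵀ b \ Χa).card := by
      rw [← hXbar', hXa, critX]; exact Finset.card_filter_add_card_filter_not _
    have h2 : (nbrs Hᵀ b \ Χa).card = dB - Χa.card := by
      rw [Finset.card_sdiff_of_subset hc.Χa_subset, card_nbrs_transpose_eq H hreg b]
    omega
  have hcolN : Yb.card + Ybar.card + Χb.card = dA := by
    have h1 : Yb.card + Ybar.card = (nbrs H a \ Χb).card := by
      rw [← hYbar', hYb, critY]; exact Finset.card_filter_add_card_filter_not _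
    have h2 : (nbrs H a \ Χb).card = dA - Χb.card := by
      rw [Finset.card_sdiff_of_subset hc.Χb_subset, card_nbrs_eq H hreg a]
    omega
  have hrow : (Xa.card : ℝ) + Xbar.card + Χa.card = dB := by exact_mod_cast hrowN
  have hcol : (Yb.card : ℝ) + Ybar.card + Χb.card = dA := by exact_mod_cast hcolN
  -- integrality of the `χ` bounds: `3|χ_a| + 1 ≤ Δ_B`
  have hZa3 : 3 * (Χa.card : ℝ) + 1 ≤ dB := by
    have h1 : (Χa.card : ℝ) ≤ 2 * δB * dB := hc.card_Χa_le
    have h2 : (3 * Χa.card : ℝ) < dB := by nlinarith [(show (0:ℝ) < dB by exact_mod_cast hdB)]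
    have h3 : 3 * Χa.card < dB := by exact_mod_cast h2
    have h4 : 3 * Χa.card + 1 ≤ dB := h3
    exact_mod_cast h4
  have hZb3 : 3 * (Χb.card : ℝ) + 1 ≤ dA := by
    have h1 : (Χb.card : ℝ) ≤ 2 * δA * dA := hc.card_Χb_le
    have h2 : (3 * Χb.card : ℝ) < dA := by nlinarith [(show (0:ℝ) < dA by exact_mod_cast hdA)]
    have h3 : 3 * Χb.card < dA := by exact_mod_cast h2
    have h4 : 3 * Χb.card + 1 ≤ dA := h3
    exact_mod_cast h4
  -- reducedness: `2 (|x_a| + |x_b|) ≤ Δ_A + Δ_B`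
  have hred : 2 * ((Xa.card : ℝ) + Yb.card) ≤ dA + dB := by
    have hA := cardA_add_row H hreg eR b a
    have hB := cardB_add_row H hreg eR b a
    have hmin' : hammingNorm eR ≤ hammingNorm (eR + expanderHZ H (b, a)) := by
      refine hmin _ ?_
      have : eR + expanderHZ H (b, a) - e = (eR - e) + expanderHZ H (b, a) := by abel
      rw [this]; exact Submodule.add_mem _ heR (expanderHZ_row_mem_rowSpace H b a)
    have hn1 : hammingNorm eR = (univ.filter fun p : A × A => eR (Sum.inl p) ≠ 0).card
        + (univ.filter fun p : B × B => eR (Sum.inr p) ≠ 0).card := by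
      simp only [hammingNorm]
      rw [Finset.card_filter, Finset.card_filter, Finset.card_filter, Fintype.sum_sum_type]
    have hn2 : hammingNorm (eR + expanderHZ H (b, a))
        = (univ.filter fun p : A × A => (eR + expanderHZ H (b, a)) (Sum.inl p) ≠ 0).card
        + (univ.filter fun p : B × B => (eR + expanderHZ H (b, a)) (Sum.inr p) ≠ 0).card := by
      simp only [hammingNorm]
      rw [Finset.card_filter, Finset.card_filter, Finset.card_filter, Fintype.sum_sum_type]
    rw [hn1, hn2] at hmin'
    have hXle : Xa.card ≤ ((nbrs Hᵀ b).filter fun α => eR (Sum.inl (α, a)) ≠ 0).card := by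
      refine Finset.card_le_card fun α hα => ?_
      rw [hXa, mem_critX] at hα
      rw [Finset.mem_filter, mem_nbrs, Matrix.transpose_apply]
      exact ⟨hα.1.1, hα.2⟩
    have hYle : Yb.card ≤ ((nbrs H a).filter fun β => eR (Sum.inr (b, β)) ≠ 0).card := by
      refine Finset.card_le_card fun β hβ => ?_
      rw [hYb, mem_critY] at hβ
      rw [Finset.mem_filter, mem_nbrs]
      exact ⟨hβ.1.1, hβ.2⟩
    have : 2 * (Xa.card + Yb.card) ≤ dA + dB := by omega
    exact_mod_cast this
  -- the two decrease bounds
  have hP := syndromeDecrease_critFlip_ge hreg hc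
  rw [hsyn] at hP
  have hQ := syndromeDecrease_flipBar_ge hc
  rw [hsyn] at hQ
  set F := critFlip H eR b a Χa Χb with hF
  set G := Xbar.image (fun α' => (Sum.inl (α', a) : (A × A) ⊕ (B × B)))
    ∪ Ybar.image (fun β' => Sum.inr (b, β')) with hG
  set G' := (nbrs Hᵀ b \ Xbar).image (fun α' => (Sum.inl (α', a) : (A × A) ⊕ (B × B)))
    ∪ (nbrs H a \ Ybar).image (fun β' => Sum.inr (b, β')) with hG'
  set P : ℝ := ((syndromeDecrease (expanderHX H) (expanderHX H *ᵥ e) F : ℤ) : ℝ) with hPdef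
  set Q : ℝ := ((syndromeDecrease (expanderHX H) (expanderHX H *ᵥ e) G : ℤ) : ℝ) with hQdef
  have hP' : (Xa.card : ℝ) * Ybar.card + Xbar.card * Yb.card - Xa.card * Χb.card - Χa.card * Yb.card ≤ P := by
    have h1 : ((Xa.card : ℤ) * ((dA : ℤ) - Χb.card - Yb.card) + ((dB : ℤ) - Χa.card - Xa.card) * Yb.card
        - Xa.card * Χb.card - Χa.card * Yb.card : ℝ)
        ≤ (syndromeDecrease (expanderHX H) (expanderHX H *ᵥ e) F : ℝ) := by exact_mod_cast hP
    have hYbar_e : (Ybar.card : ℝ) = dA - Χb.card - Yb.card := by linarith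
    have hXbar_e : (Xbar.card : ℝ) = dB - Χa.card - Xa.card := by linarith
    rw [hPdef, hYbar_e, hXbar_e]
    push_cast at h1
    linarith
  have hQ' : (Xa.card : ℝ) * Ybar.card + Xbar.card * Yb.card - Xbar.card * Χb.card - Χa.card * Ybar.card
      ≤ Q := by
    rw [hQdef]; exact_mod_cast hQ
  -- `x_a ∪ x_b ≠ ∅` and `x̄_a ∪ x̄_b ≠ ∅`
  have hposN : 1 ≤ Xa.card + Yb.card := by
    have h := card_critFlip H eR b a Χa Χb
    have hne := critFlip_nonempty hc
    have : 0 < (critFlip H eR b a Χa Χb).card := Finset.card_pos.2 hne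
    rw [h] at this
    rw [hXa, hYb]; omega
  have hpos : (1 : ℝ) ≤ Xa.card + Yb.card := by exact_mod_cast hposN
  have hbar_pos : (1 : ℝ) ≤ Xbar.card + Ybar.card := by
    by_contra hlt
    push Not at hlt
    have h0 : Xbar.card + Ybar.card = 0 := by
      by_contra hne
      have : 1 ≤ Xbar.card + Ybar.card := Nat.one_le_iff_ne_zero.2 hne
      have : (1 : ℝ) ≤ Xbar.card + Ybar.card := by exact_mod_cast this
      linarith
    have hXb0 : (Xbar.card : ℝ) = 0 := by exact_mod_cast (by omega : Xbar.card = 0)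
    have hYb0 : (Ybar.card : ℝ) = 0 := by exact_mod_cast (by omega : Ybar.card = 0)
    nlinarith
  -- the case analysis with the weight bookkeeping
  have hcases := ltz_four_cases_weight_sharp (P := P) (Q := Q) (by exact_mod_cast hdA) (by exact_mod_cast hdB)
    (Nat.cast_nonneg Xa.card) (Nat.cast_nonneg Xbar.card) (Nat.cast_nonneg Yb.card)
    (Nat.cast_nonneg Ybar.card) hrow hcol hZa3 hZb3 hred hP' hQ'
  -- sizes of the three candidates
  have hcardF : (F.card : ℝ) = Xa.card + Yb.card := by
    rw [hF]; exact_mod_cast card_critFlip H eR b a Χa Χb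
  have hcardGN : G.card = Xbar.card + Ybar.card := by rw [hG]; exact card_flipVec_parts b a Xbar Ybar
  have hcardG : (G.card : ℝ) = Xbar.card + Ybar.card := by exact_mod_cast hcardGN
  have hXbar_le : Xbar.card ≤ dB := by
    have := Finset.card_le_card hXbar_sub; rwa [card_nbrs_transpose_eq H hreg b] at this
  have hYbar_le : Ybar.card ≤ dA := by
    have := Finset.card_le_card hYbar_sub; rwa [card_nbrs_eq H hreg a] at this
  have hcardG'N : G'.card = (dB - Xbar.card) + (dA - Ybar.card) := by
    have h1 := card_flipVec_parts (A := A) (B := B) b a (nbrs Hᵀ b \ Xbar) (nbrs H a \ Ybar)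
    rw [Finset.card_sdiff_of_subset hXbar_sub, Finset.card_sdiff_of_subset hYbar_sub,
      card_nbrs_transpose_eq H hreg b, card_nbrs_eq H hreg a] at h1
    rw [hG']; exact h1
  have hcardG' : (G'.card : ℝ) = dA + dB - Xbar.card - Ybar.card := by
    rw [hcardG'N, Nat.cast_add, Nat.cast_sub hXbar_le, Nat.cast_sub hYbar_le]; ring
  have hQG' : (syndromeDecrease (expanderHX H) (expanderHX H *ᵥ e) G' : ℝ) = Q := by
    rw [hQdef, hG', hG]
    exact_mod_cast syndromeDecrease_parts_compl H b a (expanderHX H *ᵥ e) hXbar_sub hYbar_sub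
  -- the weight witnesses: `eR ⊕ 𝟙_F` (first branch) and `eR ⊕ 𝟙_{G'}` (second branch)
  have hFsub : F ⊆ supp eR := by rw [hF]; exact critFlip_subset_supp H eR b a Χa Χb
  have hwF : hammingNorm (eR + flipVec F) + F.card = hammingNorm eR := by
    have h := hammingNorm_add_flipVec eR F
    rw [Finset.inter_eq_right.2 hFsub] at h
    omega
  -- `x_a ∪ x_b ⊆ G'` and `⊆ supp eR`, so `|eR ⊕ 𝟙_{G'}| ≤ |eR| + |G'| − 2|x_a ∪ x_b|`
  have hFG' : F ⊆ G' := by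
    intro q hq
    rw [hF] at hq
    rw [hG', Finset.mem_union]
    rcases q with ⟨α, a'⟩ | ⟨b', β⟩
    · obtain ⟨rfl, hα⟩ := inl_mem_critFlip.1 hq
      left
      refine Finset.mem_image.2 ⟨α, Finset.mem_sdiff.2 ⟨?_, fun h => ?_⟩, rfl⟩
      · rw [mem_nbrs, Matrix.transpose_apply]; exact (mem_critX.1 hα).1.1
      · exact (mem_critX.1 hα).2 (Finset.mem_filter.1 h).2
    · obtain ⟨rfl, hβ⟩ := inr_mem_critFlip.1 hq
      right
      refine Finset.mem_image.2 ⟨β, Finset.mem_sdiff.2 ⟨?_, fun h => ?_⟩, rfl⟩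
      · exact mem_nbrs.2 (mem_critY.1 hβ).1.1
      · exact (mem_critY.1 hβ).2 (Finset.mem_filter.1 h).2
  have hwG'N : hammingNorm (eR + flipVec G') + 2 * F.card ≤ hammingNorm eR + G'.card := by
    have h := hammingNorm_add_flipVec eR G'
    have hsub : F ⊆ supp eR ∩ G' := Finset.subset_inter hFsub hFG'
    have := Finset.card_le_card hsub
    omega
  -- in terms of the deficit `c = |χ_a| + |χ_b| − |x_a| − |x_b|`
  have hwG' : (hammingNorm (eR + flipVec G') : ℝ)
      ≤ hammingNorm eR + (Χa.card + Χb.card - Xa.card - Yb.card) := by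
    have h1 : (hammingNorm (eR + flipVec G') : ℝ) + 2 * F.card ≤ hammingNorm eR + G'.card := by
      exact_mod_cast hwG'N
    rw [hcardG', hcardF] at h1
    linarith
  -- coset bookkeeping: `𝟙_G + 𝟙_{G'} = g_{ba}`
  have hGG' : flipVec G + flipVec G' = expanderHZ H (b, a) := by
    rw [hG, hG']; exact flipVec_parts_add_compl H b a hXbar_sub hYbar_sub
  rcases hcases with h | ⟨h, hcabs, hsharp⟩
  · -- first branch: `F = x_a ∪ x_b ⊆ E`
    refine ⟨F, critFlip_mem_smallSets hc, eR + flipVec F, by rw [hcardF]; linarith, ?_, ?_, fun _ => ?_⟩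
    · have : eR + flipVec F - (e + flipVec F) = eR - e := by abel
      rw [this]; exact heR
    · -- `|eR ⊕ 𝟙_F| = |eR| − |F| ≤ |e|` and `P ≥ |F|/3 ≥ 0`
      have hF1 : (1 : ℝ) ≤ F.card := by rw [hcardF]; exact hpos
      have h1 : (hammingNorm (eR + flipVec F) : ℝ) + F.card = hammingNorm eR := by exact_mod_cast hwF
      have h2 : (hammingNorm eR : ℝ) ≤ hammingNorm e := by exact_mod_cast hle
      rw [← hPdef]
      linarith
    · have := hwF; omega
  · -- second branch: `G = x̄_a ∪ x̄_b` or its complement `G'`, witness `eR ⊕ 𝟙_{G'}`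
    -- integrality: the deficit is an integer `< 1` when `|Δ_A − Δ_B| ≤ 5`, and `≤ 2Q − 2` always
    -- `Q ≥ 0`
    have hQ0 : (0 : ℝ) ≤ Q := by
      have hXbarR : (Xbar.card : ℝ) ≤ dB := by exact_mod_cast hXbar_le
      have hYbarR : (Ybar.card : ℝ) ≤ dA := by exact_mod_cast hYbar_le
      rcases h with h | h
      · linarith [(Nat.cast_nonneg Xbar.card : (0:ℝ) ≤ Xbar.card), (Nat.cast_nonneg Ybar.card : (0:ℝ) ≤ Ybar.card)]
      · linarith
    -- the deficit is at most a third of the decrease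
    have hZa3N : 3 * Χa.card + 1 ≤ dB := by exact_mod_cast hZa3
    have hZb3N : 3 * Χb.card + 1 ≤ dA := by exact_mod_cast hZb3
    have h3c : 3 * ((Χa.card : ℝ) + Χb.card - Xa.card - Yb.card) ≤ Q :=
      deficit_le_third_decrease hrowN hcolN hZa3N hZb3N hP' hQ' hQ0 hsharp
    have hQwt : 3 * (hammingNorm (eR + flipVec G') : ℝ) ≤ 3 * hammingNorm e + Q := by
      have h2 : (hammingNorm eR : ℝ) ≤ hammingNorm e := by exact_mod_cast hle
      linarith
    have hbal : |(dA : ℝ) - dB| ≤ 5 → hammingNorm (eR + flipVec G') ≤ hammingNorm e := by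
      intro hb
      have hlt : ((Χa.card + Χb.card : ℕ) : ℝ) < (Xa.card + Yb.card : ℕ) + 1 := by
        push_cast; linarith
      have hle' : Χa.card + Χb.card ≤ Xa.card + Yb.card := by
        have : (Χa.card + Χb.card : ℕ) < Xa.card + Yb.card + 1 := by exact_mod_cast hlt
        omega
      have h3 : (hammingNorm (eR + flipVec G') : ℝ) ≤ hammingNorm eR := by
        have : ((Χa.card : ℝ) + Χb.card - Xa.card - Yb.card) ≤ 0 := by
          have : ((Χa.card + Χb.card : ℕ) : ℝ) ≤ ((Xa.card + Yb.card : ℕ) : ℝ) := by exact_mod_cast hle'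
          push_cast at this; linarith
        linarith
      have h4 : hammingNorm (eR + flipVec G') ≤ hammingNorm eR := by exact_mod_cast h3
      exact h4.trans hle
    rcases h with h | h
    · -- flip `G = x̄_a ∪ x̄_b`
      refine ⟨G, ?_, eR + flipVec G', by rw [hcardG]; linarith, ?_, by rw [← hQdef]; exact hQwt, hbal⟩
      · refine flipVec_parts_mem_smallSets H b a hXbar_sub hYbar_sub ?_
        by_contra hne
        rw [not_or, Finset.not_nonempty_iff_eq_empty, Finset.not_nonempty_iff_eq_empty] at hne
        rw [hne.1, hne.2] at hbar_pos
        norm_num at hbar_pos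
      · -- `(eR + 𝟙_{G'}) − (e + 𝟙_G) = (eR − e) + g_{ba}` in characteristic 2
        have h1 : eR + flipVec G' - (e + flipVec G) = (eR - e) + (flipVec G + flipVec G') := by
          have h2 : (flipVec G : (A × A) ⊕ (B × B) → ZMod 2) + flipVec G = 0 := by
            funext q; rw [Pi.add_apply, Pi.zero_apply]; exact (by decide : ∀ z : ZMod 2, z + z = 0) _
          calc eR + flipVec G' - (e + flipVec G)
              = (eR - e) + (flipVec G + flipVec G') - (flipVec G + flipVec G) := by abel
            _ = (eR - e) + (flipVec G + flipVec G') := by rw [h2, sub_zero]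
        rw [h1, hGG']
        exact Submodule.add_mem _ heR (expanderHZ_row_mem_rowSpace H b a)
    · -- flip the complement `G'`
      refine ⟨G', ?_, eR + flipVec G', by rw [hQG', hcardG']; linarith, ?_, by rw [hQG']; exact hQwt, hbal⟩
      · refine flipVec_parts_mem_smallSets H b a Finset.sdiff_subset Finset.sdiff_subset ?_
        rcases hc.nonempty with ⟨α, hα, hE⟩ | ⟨β, hβ, hE⟩
        · left
          refine ⟨α, Finset.mem_sdiff.2 ⟨(Finset.mem_sdiff.1 hα).1, fun h => ?_⟩⟩
          have := (Finset.mem_filter.1 h).2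
          have hne : eR (Sum.inl (α, a)) ≠ 0 := by simpa [supp] using hE
          exact hne this
        · right
          refine ⟨β, Finset.mem_sdiff.2 ⟨(Finset.mem_sdiff.1 hβ).1, fun h => ?_⟩⟩
          have := (Finset.mem_filter.1 h).2
          have hne : eR (Sum.inr (b, β)) ≠ 0 := by simpa [supp] using hE
          exact hne this
      · have : eR + flipVec G' - (e + flipVec G') = eR - e := by abel
        rw [this]; exact heR

end QuantumExpander

end Literature.InformationTheory.QuantumCodes
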